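import Literature.Computability.QuantumComplexity.CWrapLayout
import Literature.Computability.QuantumComplexity.RevMultiplex
import HarnessLib

/-!
# Classical wrapping inside quantum search, II: the reversible programs and their semantics

Trunk `CryptoQuantFine`; second file of the construction discharging
`Literature.Computability.Cryptography.isQSolvable_classicalWrap` (see `CWrapLayout.lean` for
the layout and the plan). Here: the full parameter structure (adding the machine of the
wrapped post-processor `gWrap g`), the three classical reversible programs of the wrapped
family over `ℕ`-indexed wires —

* `prog1 n` = block of `h` ++ length flags (`RevMux.flagOps`) ++ router (`RevMux.muxOps`),
* `progConj n ℓ` = the swap of the front window `[0, Pw)` with block `ℓ` (`RevMux.swapOps`),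
* `prog2 n` = block of `gWrap g` (data = all `D n` wires so far) ++ the final swap of its
  output bits onto the front wires —

their well-formedness and wire bounds (so that they compile to Clifford+T words on
`n + anc n` wires, `clamp`), and the **semantics of `prog1`** on the input `x 0 0 …`
(`clEval_prog1_flagW`: the flags are one-hot at `|h x|`; `clEval_prog1_blockW`: block `|h x|`
holds `h x` padded with zeros, all other blocks are zero; data wires keep `x`; everything from
`D n` on is still zero).

## References

* E. Bernstein, U. Vazirani, *Quantum complexity theory*, SIAM J. Comput. 26 (1997), §8.
* M. A. Nielsen, I. L. Chuang, *Quantum Computation and Quantum Information*, CUP 2010,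
  §3.2.5, §4.5.5.
* S. Arora, B. Barak, *Computational Complexity: A Modern Approach*, CUP 2009, §6.2.
-/

noncomputable section

namespace Literature.Computability.QuantumComplexity

namespace CWrap

open _root_.Computability Complexity Complexity.FinTM2Sim Turing Function RevSim RevClean Cryptography RevMux

/-! ### Parameters -/

/-- Full parameters (a hypothesis structure): a layout together with the post-processor `g` and
a machine computing the wrapped post-processor `gWrap g` within `(n+2)^eg` steps. [folklore] -/
structure Params extends Layout where
  /-- the post-processor -/
  g : List Bool → List Bool
  /-- time exponent of the machine of the wrapped post-processor -/
  eg : ℕ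
  /-- the machine of the wrapped post-processor -/
  Mg : TM2ComputableAux Bool Bool
  /-- it computes `gWrap g` within `(n+2)^eg` steps -/
  hMg : ∀ u, Mg.OutputsWithin u (gWrap toLayout g u) (Tn eg u.length)

variable (P : Params)

/-- The number of output cells of the post-processor block (the front window receiving the
output bits). [folklore] -/
def Pg (n : ℕ) : ℕ := JJ P.eg P.Mg (nG P.toLayout n)

/-- The total number of wires: the width of the post-processor block, whose data wires are all
the `D n` wires before it. [folklore] -/
def widthG (n : ℕ) : ℕ := RevClean.width P.eg P.Mg (nG P.toLayout n)

/-- The number of ancillas. [folklore] -/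
def anc (n : ℕ) : ℕ := widthG P n - n

/-- The `true`-code wire of output cell `j` of the post-processor block. [folklore] -/
def tWg (n j : ℕ) : ℕ := resW P.eg P.Mg (nG P.toLayout n) j (symTrue P.Mg)

/-! ### Size bookkeeping -/

/-- `widthH ≤ D`. [folklore] -/
theorem widthH_le_D (Q : Layout) (n : ℕ) : widthH Q n ≤ D Q n := by unfold D baseB; omega

/-- `baseB ≤ D`. [folklore] -/
theorem baseB_le_D (Q : Layout) (n : ℕ) : baseB Q n ≤ D Q n := by unfold D; omega

/-- `D < nG`. [folklore] -/
theorem D_lt_nG (Q : Layout) (n : ℕ) : D Q n < nG Q n := by unfold nG; rw [length_vg]; omega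

/-- `nG ≤ widthG`. [folklore] -/
theorem nG_le_widthG (n : ℕ) : nG P.toLayout n ≤ widthG P n :=
  (le_NN (e := P.eg) (M := P.Mg) _).trans (NN_le_width _)

/-- `D < widthG`. [folklore] -/
theorem D_lt_widthG (n : ℕ) : D P.toLayout n < widthG P n := lt_of_lt_of_le (D_lt_nG _ n) (nG_le_widthG P n)

/-- `n ≤ D`. [folklore] -/
theorem le_D (Q : Layout) (n : ℕ) : n ≤ D Q n := (le_widthH Q n).trans (widthH_le_D Q n)

/-- **`n + anc n = widthG n`.** [folklore] -/
theorem n_add_anc (n : ℕ) : n + anc P n = widthG P n := by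
  have := (le_D P.toLayout n).trans (D_lt_widthG P n).le
  unfold anc; omega

/-- There is a wire. [folklore] -/
theorem widthG_pos (n : ℕ) : 0 < n + anc P n := by
  rw [n_add_anc]; exact lt_of_le_of_lt (Nat.zero_le _) (D_lt_widthG P n)

/-- Output wires lie inside the post-processor block. [folklore] -/
theorem tWg_lt_widthG {n j : ℕ} (hj : j < Pg P n) : tWg P n j < widthG P n := resW_lt_width hj _

/-- `Pg ≤ NN ≤ tWg`: the front window is below the output wires. [folklore] -/
theorem Pg_le_tWg (n j : ℕ) : Pg P n ≤ tWg P n j :=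
  (JJ_le_NN _).trans (NN_le_resW _ _ _)

/-- `Pg ≤ widthG`. [folklore] -/
theorem Pg_le_widthG (n : ℕ) : Pg P n ≤ widthG P n := (JJ_le_NN _).trans (NN_le_width _)

/-! ### The programs -/

/-- The block of `h`, at its canonical position. [cite: Shor1997, §3 p.8 (compute F(x) keeping x, copy, undo)] -/
def progH (n : ℕ) : List (ClOp ℕ) := cleanOps P.eh P.Mh n []

/-- The length flags. [folklore] -/
def progFlags (n : ℕ) : List (ClOp ℕ) := flagOps (empW P.toLayout n) (flagW P.toLayout n) (Lh P.toLayout n)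

/-- The router: bit `i < ℓ` of `h x` into wire `i` of block `ℓ`, under flag `ℓ`. [cite: AroraBarak2009, §6.2 (a circuit for each input length, hard-wired)] -/
def progRoute (n : ℕ) : List (ClOp ℕ) :=
  muxOps (flagW P.toLayout n) (fun _ i => tWh P.toLayout n i) (blockW P.toLayout n) (fun ℓ => ℓ) (Lh P.toLayout n)

/-- **Stage 1.** [folklore] -/
def prog1 (n : ℕ) : List (ClOp ℕ) := progH P n ++ (progFlags P n ++ progRoute P n)

/-- The pairs (front wire `i`, wire `i` of block `ℓ`), `i < Pw`. [folklore] -/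
def conjPairs (n ℓ : ℕ) : List (ℕ × ℕ) := (List.range (Pw P.toLayout n)).map fun i => (i, blockW P.toLayout n ℓ i)

/-- **The conjugating swap of block `ℓ` with the front window.** [cite: NielsenChuang2010, §1.3.4 (swap from three CNOTs)] -/
def progConj (n ℓ : ℕ) : List (ClOp ℕ) := swapOps (conjPairs P n ℓ)

/-- The block of the wrapped post-processor: data = the `D n` wires so far, suffix `vg n`. [cite: Shor1997, §3 p.8 (compute F(x) keeping x, copy, undo)] -/
def progG (n : ℕ) : List (ClOp ℕ) := cleanOps P.eg P.Mg (D P.toLayout n) (vg n)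

/-- The pairs (output wire `j`, front wire `j`), `j < Pg`. [folklore] -/
def outPairs (n : ℕ) : List (ℕ × ℕ) := (List.range (Pg P n)).map fun j => (tWg P n j, j)

/-- The final swap of the output bits onto the front. [cite: NielsenChuang2010, §1.3.4 (swap from three CNOTs)] -/
def progOut (n : ℕ) : List (ClOp ℕ) := swapOps (outPairs P n)

/-- **Stage 2.** [folklore] -/
def prog2 (n : ℕ) : List (ClOp ℕ) := progG P n ++ progOut P n

/-! ### Well-formedness -/

/-- The hypotheses of the flag gadget hold in the layout. [folklore] -/
theorem hef_layout (Q : Layout) (n : ℕ) : ∀ i ≤ Lh Q n, ∀ j ≤ Lh Q n, empW Q n i ≠ flagW Q n j :=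
  fun _ hi _ _ => Nat.ne_of_lt (lt_of_lt_of_le (empW_lt_widthH Q hi) (Nat.le_add_right _ _))

/-- `prog1` is well formed. [folklore] -/
theorem prog1_wf (n : ℕ) : ∀ op ∈ prog1 P n, op.WF := by
  intro op hop
  simp only [prog1, List.mem_append] at hop
  rcases hop with hop | hop | hop
  · exact cleanOps_wf op hop
  · exact flagOps_wf_bdd _ _ (hef_layout P.toLayout n) (empW_injective P.toLayout n) op hop
  · refine muxOps_wf (fun ℓ hℓ i _ ℓ' hℓ' => ?_) (fun ℓ _ i _ ℓ' hℓ' i' hi' => ?_) (fun ℓ hℓ i hi => ?_) op hop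
    · exact (Nat.ne_of_lt (lt_of_lt_of_le (flagW_lt_baseB _ hℓ') (baseB_le_blockW _ n ℓ i))).symm
    · exact (Nat.ne_of_lt (lt_of_lt_of_le ((tWh_lt_widthH _ (by omega)).trans (widthH_lt_baseB _ n))
        (baseB_le_blockW _ n ℓ i))).symm
    · exact (Nat.ne_of_lt (lt_of_lt_of_le (tWh_lt_widthH _ (by omega)) (Nat.le_add_right _ _))).symm

/-- `progConj` is well formed. [folklore] -/
theorem progConj_wf (n ℓ : ℕ) : ∀ op ∈ progConj P n ℓ, op.WF := by
  refine swapOps_wf fun p hp => ?_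
  simp only [conjPairs, List.mem_map, List.mem_range] at hp
  obtain ⟨i, hi, rfl⟩ := hp
  exact Nat.ne_of_lt (lt_of_lt_of_le hi ((Pw_le_baseB _ n).trans (baseB_le_blockW _ n ℓ i)))

/-- `prog2` is well formed. [folklore] -/
theorem prog2_wf (n : ℕ) : ∀ op ∈ prog2 P n, op.WF := by
  intro op hop
  simp only [prog2, List.mem_append] at hop
  rcases hop with hop | hop
  · exact cleanOps_wf op hop
  · refine swapOps_wf (fun p hp => ?_) op hop
    simp only [outPairs, List.mem_map, List.mem_range] at hp
    obtain ⟨j, hj, rfl⟩ := hp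
    exact (Nat.ne_of_lt (lt_of_lt_of_le hj (Pg_le_tWg P n j))).symm

/-! ### Wire bounds -/

/-- The wires of a swap layer are the components of its pairs. [folklore] -/
theorem wiresOf_swapOps {ps : List (ℕ × ℕ)} {op : ClOp ℕ} (hop : op ∈ swapOps ps) :
    ∀ i ∈ wiresOf op, ∃ p ∈ ps, i = p.1 ∨ i = p.2 := by
  intro i hi
  obtain ⟨p, hp, rfl | rfl⟩ := mem_swapOps hop
  · simp only [mem_wiresOf, ClOp.target, ClOp.controls, List.mem_singleton] at hi
    rcases hi with rfl | rfl
    · exact ⟨p, hp, Or.inr rfl⟩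
    · exact ⟨p, hp, Or.inl rfl⟩
  · simp only [mem_wiresOf, ClOp.target, ClOp.controls, List.mem_singleton] at hi
    rcases hi with rfl | rfl
    · exact ⟨p, hp, Or.inl rfl⟩
    · exact ⟨p, hp, Or.inr rfl⟩

/-- `prog1` uses wires below `D`. [folklore] -/
theorem prog1_lt (n : ℕ) : ∀ op ∈ prog1 P n, ∀ i ∈ wiresOf op, i < D P.toLayout n := by
  intro op hop i hi
  simp only [prog1, List.mem_append] at hop
  rcases hop with hop | hop | hop
  · have h := cleanOps_lt op hop i hi
    simp only [List.length_nil, Nat.add_zero] at h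
    exact lt_of_lt_of_le (show i < widthH P.toLayout n from h) (widthH_le_D _ n)
  · -- flags: emptiness wires and flag wires
    have hLD : widthH P.toLayout n + (Lh P.toLayout n + 1) ≤ D P.toLayout n := by unfold D baseB; omega
    simp only [progFlags, flagOps, List.mem_cons, List.mem_flatMap, List.mem_range] at hop
    rcases hop with rfl | ⟨ℓ, hℓ, hop⟩
    · simp only [mem_wiresOf, ClOp.target, ClOp.controls, List.mem_singleton] at hi
      rcases hi with rfl | rfl
      · unfold flagW; omega
      · exact lt_of_lt_of_le (empW_lt_widthH _ (Nat.zero_le _)) (widthH_le_D _ n)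
    · simp only [List.not_mem_nil, or_false] at hop
      have hemp : ∀ j ≤ Lh P.toLayout n, empW P.toLayout n j < D P.toLayout n := fun j hj =>
        lt_of_lt_of_le (empW_lt_widthH _ hj) (widthH_le_D _ n)
      rcases hop with rfl | rfl | rfl <;>
        simp only [mem_wiresOf, ClOp.target, ClOp.controls, List.mem_cons, List.not_mem_nil, or_false] at hi
      · subst hi; exact hemp ℓ hℓ.le
      · rcases hi with rfl | rfl | rfl
        · unfold flagW; omega
        · exact hemp (ℓ + 1) hℓ
        · exact hemp ℓ hℓ.le
      · subst hi; exact hemp ℓ hℓ.le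
  · obtain ⟨ℓ, hℓ, j, hj, rfl⟩ := mem_muxOps.1 hop
    simp only [mem_wiresOf, ClOp.target, ClOp.controls, List.mem_cons, List.not_mem_nil, or_false] at hi
    have hPw : j < Pw P.toLayout n := by unfold Pw; omega
    rcases hi with rfl | rfl | rfl
    · exact blockW_lt_D _ hℓ hPw
    · exact lt_of_lt_of_le (flagW_lt_baseB _ hℓ) (baseB_le_D _ n)
    · exact lt_of_lt_of_le ((tWh_lt_widthH _ (by omega)).trans (widthH_lt_baseB _ n)) (baseB_le_D _ n)

/-- `progConj n ℓ`, `ℓ ≤ L(n)`, uses wires below `D`. [folklore] -/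
theorem progConj_lt {n ℓ : ℕ} (hℓ : ℓ ≤ Lh P.toLayout n) : ∀ op ∈ progConj P n ℓ, ∀ i ∈ wiresOf op, i < D P.toLayout n := by
  intro op hop i hi
  obtain ⟨p, hp, h⟩ := wiresOf_swapOps hop i hi
  simp only [conjPairs, List.mem_map, List.mem_range] at hp
  obtain ⟨k, hk, rfl⟩ := hp
  rcases h with rfl | rfl
  · exact lt_of_lt_of_le hk ((Pw_le_baseB _ n).trans (baseB_le_D _ n))
  · exact blockW_lt_D _ hℓ hk

/-- `prog2` uses wires below the total width. [folklore] -/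
theorem prog2_lt (n : ℕ) : ∀ op ∈ prog2 P n, ∀ i ∈ wiresOf op, i < widthG P n := by
  intro op hop i hi
  simp only [prog2, List.mem_append] at hop
  rcases hop with hop | hop
  · have h := cleanOps_lt op hop i hi
    unfold widthG nG
    exact h
  · obtain ⟨p, hp, h⟩ := wiresOf_swapOps hop i hi
    simp only [outPairs, List.mem_map, List.mem_range] at hp
    obtain ⟨j, hj, rfl⟩ := hp
    rcases h with rfl | rfl
    · exact tWg_lt_widthG P hj
    · exact lt_of_lt_of_le hj (Pg_le_widthG P n)

/-! ### Compilation on `n + anc n` wires -/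

/-- A program over `ℕ` with wires below `n + anc n`, re-indexed to `Fin (n + anc n)` and turned
into reversible operations (`RevGadgets.toRevList`). [cite: AroraBarak2009, §10.3.7 Lemma 10.10] -/
def clamp (n : ℕ) (ops : List (ClOp ℕ)) (hlt : ∀ op ∈ ops, ∀ i ∈ wiresOf op, i < n + anc P n)
    (hwf : ∀ op ∈ ops, op.WF) : List (RevOp (n + anc P n)) :=
  toRevList (ops.map (ClOp.map (finOf (n + anc P n) (widthG_pos P n)))) fun op hop => by
    simp only [List.mem_map] at hop
    obtain ⟨op, hop, rfl⟩ := hop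
    exact wf_map_finOf _ (hlt op hop) (hwf op hop)

/-- **Semantics of a clamped program**: on `Fin (n + anc n)` it acts as the `ℕ`-program on the
lifted assignment. [folklore] -/
theorem revEval_clamp (n : ℕ) (ops : List (ClOp ℕ)) (hlt : ∀ op ∈ ops, ∀ i ∈ wiresOf op, i < n + anc P n)
    (hwf : ∀ op ∈ ops, op.WF) (w : QReg (n + anc P n)) (p : Fin (n + anc P n)) :
    revEval (clamp P n ops hlt hwf) w p = clEval ops (liftW w) p := by
  unfold clamp
  rw [revEval_toRevList, clEval_map_finOf_apply _ ops hlt]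

/-- `prog1` fits. [folklore] -/
theorem prog1_lt' (n : ℕ) : ∀ op ∈ prog1 P n, ∀ i ∈ wiresOf op, i < n + anc P n := fun op hop i hi => by
  rw [n_add_anc]; exact (prog1_lt P n op hop i hi).trans (D_lt_widthG P n)

/-- `progConj` fits (for `ℓ ≤ L(n)`). [folklore] -/
theorem progConj_lt' {n ℓ : ℕ} (hℓ : ℓ ≤ Lh P.toLayout n) : ∀ op ∈ progConj P n ℓ, ∀ i ∈ wiresOf op, i < n + anc P n :=
  fun op hop i hi => by rw [n_add_anc]; exact (progConj_lt P hℓ op hop i hi).trans (D_lt_widthG P n)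

/-- `prog2` fits. [folklore] -/
theorem prog2_lt' (n : ℕ) : ∀ op ∈ prog2 P n, ∀ i ∈ wiresOf op, i < n + anc P n := fun op hop i hi => by
  rw [n_add_anc]; exact prog2_lt P n op hop i hi

/-! ### Semantics of stage 1 -/

section Stage1

variable (x : List Bool)

/-- The assignment after the block of `h`. [folklore] -/
def wH : ℕ → Bool := clEval (progH P x.length) (strW x)

/-- The assignment after the flags. [folklore] -/
def wF : ℕ → Bool := clEval (progFlags P x.length) (wH P x)

/-- **The assignment after stage 1.** [folklore] -/
def w1 : ℕ → Bool := clEval (prog1 P x.length) (strW x)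

/-- `w1` is the router applied to `wF`. [folklore] -/
theorem w1_eq : w1 P x = clEval (progRoute P x.length) (wF P x) := by
  unfold w1 wF wH prog1
  rw [clEval_append, clEval_append]

/-- After the block of `h`: wires from `widthH` on are `0`. [folklore] -/
theorem wH_of_widthH_le {i : ℕ} (hi : widthH P.toLayout x.length ≤ i) : wH P x i = false :=
  clEval_blockH_of_widthH_le P.toLayout x hi

/-- **The flags are one-hot at `|h x|`.** [folklore] -/
theorem wF_flagW {ℓ : ℕ} (hℓ : ℓ ≤ Lh P.toLayout x.length) : wF P x (flagW P.toLayout x.length ℓ) = decide (ℓ = (P.h x).length) := by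
  unfold wF progFlags
  rw [clEval_flagOps_flag_bdd _ _ (empW_injective _ _) (flagW_injective _ _) _ (hef_layout _ _)
    (fun ℓ' _ => wH_of_widthH_le P x (Nat.le_add_right _ _)) hℓ]
  exact flagVal_profile (empW P.toLayout x.length) (wH P x) (P.h x).length
    (fun j hj => clEval_blockH_empW P.toLayout x hj) hℓ

/-- The flags change nothing but the flags. [folklore] -/
theorem wF_of_forall_ne {i : ℕ} (hi : ∀ ℓ ≤ Lh P.toLayout x.length, i ≠ flagW P.toLayout x.length ℓ) : wF P x i = wH P x i := by
  unfold wF progFlags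
  exact clEval_flagOps_of_forall_ne_bdd _ _ (empW_injective _ _) (flagW_injective _ _) _ (hef_layout _ _)
    (fun ℓ' _ => wH_of_widthH_le P x (Nat.le_add_right _ _)) hi

/-- A wire that is not a flag. [folklore] -/
theorem ne_flagW_of_lt {i : ℕ} (hi : i < widthH P.toLayout x.length) : ∀ ℓ ≤ Lh P.toLayout x.length, i ≠ flagW P.toLayout x.length ℓ :=
  fun ℓ _ h => absurd hi (by rw [h]; unfold flagW; omega)

/-- A wire that is not a flag. [folklore] -/
theorem ne_flagW_of_baseB_le {i : ℕ} (hi : baseB P.toLayout x.length ≤ i) : ∀ ℓ ≤ Lh P.toLayout x.length, i ≠ flagW P.toLayout x.length ℓ :=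
  fun ℓ hℓ h => absurd (flagW_lt_baseB P.toLayout hℓ) (by rw [← h]; exact Nat.not_lt.2 hi)

/-- After the flags: the `true`-code wires still read the bits of `h x`. [folklore] -/
theorem wF_tWh {i : ℕ} (hi : i < (P.h x).length) : wF P x (tWh P.toLayout x.length i) = (P.h x)[i] := by
  have hiL : i ≤ Lh P.toLayout x.length := (Nat.le_of_lt hi).trans (length_h_le_Lh P.toLayout x)
  rw [wF_of_forall_ne P x (ne_flagW_of_lt P x (tWh_lt_widthH _ hiL))]
  exact clEval_blockH_tWh P.toLayout x hi

/-- After the flags: block wires are still `0`. [folklore] -/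
theorem wF_blockW (ℓ i : ℕ) : wF P x (blockW P.toLayout x.length ℓ i) = false := by
  rw [wF_of_forall_ne P x (ne_flagW_of_baseB_le P x (baseB_le_blockW _ _ ℓ i))]
  exact wH_of_widthH_le P x ((widthH_lt_baseB _ _).le.trans (baseB_le_blockW _ _ ℓ i))

/-- **Block `|h x|` holds `h x` padded with zeros; every other block is zero.** [cite: AroraBarak2009, §6.2 (a circuit for each input length, hard-wired)] -/
theorem w1_blockW {ℓ i : ℕ} (hℓ : ℓ ≤ Lh P.toLayout x.length) (hi : i < Pw P.toLayout x.length) :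
    w1 P x (blockW P.toLayout x.length ℓ i) = (decide (ℓ = (P.h x).length) && (P.h x).getD i false) := by
  rw [w1_eq]
  unfold progRoute
  by_cases hiℓ : i < ℓ
  · rw [clEval_muxOps_route (wF P x) (P.h x).length (fun ℓ' hℓ' => wF_flagW P x hℓ')
      (fun ℓ₁ hℓ₁ i₁ _ ℓ₂ hℓ₂ => (Nat.ne_of_lt (lt_of_lt_of_le (flagW_lt_baseB _ hℓ₂) (baseB_le_blockW _ _ ℓ₁ i₁))).symm)
      (fun ℓ₁ _ i₁ _ ℓ₂ hℓ₂ i₂ hi₂ => (Nat.ne_of_lt (lt_of_lt_of_le ((tWh_lt_widthH _ (by omega)).trans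
        (widthH_lt_baseB _ _)) (baseB_le_blockW _ _ ℓ₁ i₁))).symm)
      (fun ℓ₁ hℓ₁ i₁ hi₁ ℓ₂ hℓ₂ i₂ hi₂ h => blockW_inj _ (by unfold Pw; omega) (by unfold Pw; omega) h) hℓ hiℓ,
      wF_blockW, Bool.false_xor]
    by_cases he : ℓ = (P.h x).length
    · subst he
      rw [wF_tWh P x hiℓ]
      simp [List.getD_eq_getElem?_getD, List.getElem?_eq_getElem hiℓ]
    · simp [he]
  · rw [clEval_muxOps_of_forall_ne (wF P x) (fun ℓ' hℓ' i' hi' h => ?_), wF_blockW]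
    · by_cases he : ℓ = (P.h x).length
      · subst he
        have : (P.h x).length ≤ i := Nat.not_lt.1 hiℓ
        simp [List.getD_eq_getElem?_getD, List.getElem?_eq_none this]
      · simp [he]
    · obtain ⟨rfl, rfl⟩ := blockW_inj _ (by unfold Pw; omega) hi h
      exact hiℓ hi'

/-- Stage 1 keeps the data wires. [folklore] -/
theorem w1_of_lt {i : ℕ} (hi : i < x.length) : w1 P x i = x.getD i false := by
  rw [w1_eq]
  unfold progRoute
  rw [clEval_muxOps_of_forall_ne (wF P x) (fun ℓ _ i' _ h => ?_)]
  · rw [wF_of_forall_ne P x (ne_flagW_of_lt P x (lt_of_lt_of_le hi (le_widthH _ _)))]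
    exact clEval_blockH_of_lt P.toLayout x hi
  · have := baseB_le_blockW P.toLayout x.length ℓ i'
    have := widthH_lt_baseB P.toLayout x.length
    have := le_widthH P.toLayout x.length
    omega

/-- Stage 1 leaves everything from `D` on at `0`. [folklore] -/
theorem w1_of_D_le {i : ℕ} (hi : D P.toLayout x.length ≤ i) : w1 P x i = false := by
  unfold w1
  rw [clEval_apply_of_forall_target_ne _ _ (fun op hop h => ?_)]
  · unfold strW
    rw [List.getD_eq_getElem?_getD, List.getElem?_eq_none ((le_D _ _).trans hi)]
    rfl
  · have := prog1_lt P x.length op hop op.target (by simp [mem_wiresOf])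
    omega

/-- **The flags after stage 1** (the router does not touch them). [folklore] -/
theorem w1_flagW {ℓ : ℕ} (hℓ : ℓ ≤ Lh P.toLayout x.length) : w1 P x (flagW P.toLayout x.length ℓ) = decide (ℓ = (P.h x).length) := by
  rw [w1_eq]
  unfold progRoute
  rw [clEval_muxOps_of_forall_ne (wF P x) (fun ℓ' _ i' _ h => ?_)]
  · exact wF_flagW P x hℓ
  · exact absurd (flagW_lt_baseB P.toLayout hℓ) (by rw [← h]; exact Nat.not_lt.2 (baseB_le_blockW _ _ _ _))

end Stage1

end CWrap

end Literature.Computability.QuantumComplexity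

end
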